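import Mathlib
import Summits.ValiantsHypothesis.ValiantsHypothesis.Theorems.SymmetroidPencilBasics

/-!
# ValiantsHypothesis / LacunarySymmetroid — crux `MatrixDescartes` (stmt-ValiantsHypothesis-18050),
# line `Cruxes/MatrixDescartes/Lines/sign_split.lean`, stub `stub_perturb` (`PerturbToAlternation`,
# δ-equal to `lorentzian_shadow`'s `stub_perturbT8`): PARTIAL LEMMAS — odd-multiplicity roots are alternations

Helper file (`--supports stmt-ValiantsHypothesis-18050 --as helper`; cell val-lit, seat val-lit-p5 g9, merged desk
RULING #80).  Closes NO item and does NOT prove the stub; «V1 line stub; `MatrixDescartes` / Conjecture B /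
`VP ≠ VNP` OPEN».

The stub `PerturbToAlternation` says: if every symmetric pencil `Σ_l X^{d_l} S_l` of format `(d, m)` has at most
`B` strict sign alternations of its determinant along positive points, then every symmetric pencil of that format has
at most `2B` distinct positive roots.  Its proof has two halves: (a) roots of ODD multiplicity are sign changes of
`det F` itself; (b) roots of EVEN multiplicity become sign changes of `det (F ± ε X^{d} E)` for a generic `E ≻ 0`
and one of the two signs (local spectral analysis).  This file proves half (a) in full, for an arbitrary nonzero real
polynomial, and draws the stub-shaped consequences:

* `eval_mul_eval_sign` — SIGN CALCULUS: for a real polynomial `p ≠ 0` and non-roots `x < y`,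
  `(-1)^{c} · p(x) p(y) > 0` where `c` = number of roots of `p` in `(x, y)` counted with multiplicity
  (`Polynomial.exists_prod_multiset_X_sub_C_mul` + IVT for the root-free cofactor);
* **`exists_alternation_of_odd_roots`** — if `p ≠ 0` has `n` positive roots of odd multiplicity, there are positive
  points `τ_0 < ⋯ < τ_n` with `p(τ_j) p(τ_{j+1}) < 0`;
* **`card_oddPosRoots_le`** — under the stub's hypothesis (format `(d, m)`, bound `B`), every symmetric pencil of
  that format has at most `B` positive roots of odd multiplicity; in particular (**`posRootCount_le_of_odd`**) the
  stub's conclusion `posRootCount ≤ 2B` (indeed `≤ B`) holds whenever all positive roots are of odd multiplicity.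

The residual content of the stub is exactly half (b), isolated here as the statement one would need per even root
(docstring of `card_oddPosRoots_le`); it is NOT proved in this file.
-/

set_option linter.dupNamespace false

namespace Summit.ValiantsHypothesis.ValiantsHypothesis.Theorems.LacunarySymmetroidMatrixDescartes

open Polynomial Finset

namespace Perturb

/-! ## 1. Sign calculus for real polynomials -/

/-- A nonzero real polynomial without real roots has constant sign: `q(x) q(y) > 0`. -/
theorem eval_mul_eval_pos_of_roots_eq_zero (q : ℝ[X]) (hq : q ≠ 0) (hroots : q.roots = 0) (x y : ℝ) :
    0 < q.eval x * q.eval y := by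
  have hne : ∀ z, q.eval z ≠ 0 := by
    intro z hz
    have : z ∈ q.roots := (Polynomial.mem_roots hq).mpr hz
    rw [hroots] at this
    exact Multiset.notMem_zero z this
  have hcont : Continuous fun t => q.eval t := Polynomial.continuous q
  -- no sign change between any two points, by the intermediate value theorem
  have key : ∀ a b : ℝ, a ≤ b → 0 < q.eval a * q.eval b := by
    intro a b hab
    rcases lt_trichotomy 0 (q.eval a * q.eval b) with h | h | h
    · exact h
    · exact absurd h.symm (mul_ne_zero (hne a) (hne b))
    · exfalso
      rcases mul_neg_iff.mp h with ⟨ha, hb⟩ | ⟨ha, hb⟩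
      · obtain ⟨z, -, hz⟩ := intermediate_value_Icc' hab hcont.continuousOn ⟨hb.le, ha.le⟩
        exact hne z hz
      · obtain ⟨z, -, hz⟩ := intermediate_value_Icc hab hcont.continuousOn ⟨ha.le, hb.le⟩
        exact hne z hz
  rcases le_total x y with hxy | hxy
  · exact key x y hxy
  · rw [mul_comm]; exact key y x hxy

/-- Sign of `∏_{ρ ∈ T} (x - ρ)(y - ρ)` for `x < y` outside `T`: `(-1)^{#(T ∩ (x,y))}` (with multiplicity). -/
theorem prod_sub_mul_sub_sign (x y : ℝ) (hxy : x < y) :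
    ∀ T : Multiset ℝ, (∀ ρ ∈ T, ρ ≠ x ∧ ρ ≠ y) →
      0 < (-1 : ℝ) ^ (T.countP fun ρ => x < ρ ∧ ρ < y) * (T.map fun ρ => (x - ρ) * (y - ρ)).prod := by
  intro T
  induction T using Multiset.induction_on with
  | empty => intro; simp
  | cons ρ T ih =>
    intro hT
    have hρ := hT ρ (Multiset.mem_cons_self ρ T)
    have ih' := ih fun σ hσ => hT σ (Multiset.mem_cons_of_mem hσ)
    rw [Multiset.countP_cons, Multiset.map_cons, Multiset.prod_cons]
    by_cases hin : x < ρ ∧ ρ < y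
    · rw [if_pos hin, pow_succ]
      have hf : (x - ρ) * (y - ρ) < 0 := mul_neg_of_neg_of_pos (by linarith [hin.1]) (by linarith [hin.2])
      have : (-1 : ℝ) ^ (T.countP fun ρ => x < ρ ∧ ρ < y) * (-1) * ((x - ρ) * (y - ρ) *
          (T.map fun ρ => (x - ρ) * (y - ρ)).prod) =
          (-((x - ρ) * (y - ρ))) * ((-1 : ℝ) ^ (T.countP fun ρ => x < ρ ∧ ρ < y) *
            (T.map fun ρ => (x - ρ) * (y - ρ)).prod) := by ring
      rw [this]
      exact mul_pos (by linarith) ih'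
    · rw [if_neg hin, add_zero]
      have hf : 0 < (x - ρ) * (y - ρ) := by
        rcases lt_or_gt_of_ne hρ.1 with h1 | h1
        · -- ρ < x < y
          exact mul_pos (by linarith) (by linarith)
        · -- x < ρ, so ρ ≥ y, and ρ ≠ y gives ρ > y
          have h2 : y < ρ := by
            rcases lt_or_gt_of_ne hρ.2 with h2 | h2
            · exact absurd ⟨h1, h2⟩ hin
            · exact h2
          exact mul_pos_of_neg_of_neg (by linarith) (by linarith)
      have : (-1 : ℝ) ^ (T.countP fun ρ => x < ρ ∧ ρ < y) * ((x - ρ) * (y - ρ) *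
          (T.map fun ρ => (x - ρ) * (y - ρ)).prod) =
          ((x - ρ) * (y - ρ)) * ((-1 : ℝ) ^ (T.countP fun ρ => x < ρ ∧ ρ < y) *
            (T.map fun ρ => (x - ρ) * (y - ρ)).prod) := by ring
      rw [this]
      exact mul_pos hf ih'

/-- **Sign calculus.**  For a real polynomial `p ≠ 0` and non-roots `x < y`:
`(-1)^{c} · p(x) · p(y) > 0`, where `c` is the number of roots of `p` in `(x, y)` counted with multiplicity. -/
theorem eval_mul_eval_sign (p : ℝ[X]) (hp : p ≠ 0) (x y : ℝ) (hxy : x < y) (hx : p.eval x ≠ 0)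
    (hy : p.eval y ≠ 0) :
    0 < (-1 : ℝ) ^ (p.roots.countP fun ρ => x < ρ ∧ ρ < y) * (p.eval x * p.eval y) := by
  obtain ⟨q, hpq, -, hqroots⟩ := Polynomial.exists_prod_multiset_X_sub_C_mul p
  have hq : q ≠ 0 := by
    rintro rfl
    rw [mul_zero] at hpq
    exact hp hpq.symm
  have hevx : ∀ z : ℝ, p.eval z = (p.roots.map fun ρ => z - ρ).prod * q.eval z := by
    intro z
    conv_lhs => rw [← hpq]
    rw [Polynomial.eval_mul, Polynomial.eval_multiset_prod, Multiset.map_map]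
    congr 2
    refine Multiset.map_congr rfl fun ρ _ => ?_
    simp
  have hT : ∀ ρ ∈ p.roots, ρ ≠ x ∧ ρ ≠ y := by
    intro ρ hρ
    have hr := (Polynomial.mem_roots hp).mp hρ
    exact ⟨fun h => hx (h ▸ hr), fun h => hy (h ▸ hr)⟩
  have h1 := prod_sub_mul_sub_sign x y hxy p.roots hT
  have h2 := eval_mul_eval_pos_of_roots_eq_zero q hq hqroots x y
  have hrw : p.eval x * p.eval y =
      (p.roots.map fun ρ => (x - ρ) * (y - ρ)).prod * (q.eval x * q.eval y) := by
    rw [hevx x, hevx y, Multiset.prod_map_mul]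
    ring
  rw [hrw, ← mul_assoc]
  exact mul_pos h1 h2

/-- Consequence: an ODD number of roots (with multiplicity) strictly between two non-roots `x < y` forces a sign
change `p(x) p(y) < 0`. -/
theorem eval_mul_eval_neg_of_odd (p : ℝ[X]) (hp : p ≠ 0) (x y : ℝ) (hxy : x < y) (hx : p.eval x ≠ 0)
    (hy : p.eval y ≠ 0) (hodd : Odd (p.roots.countP fun ρ => x < ρ ∧ ρ < y)) :
    p.eval x * p.eval y < 0 := by
  have h := eval_mul_eval_sign p hp x y hxy hx hy
  rw [hodd.neg_one_pow] at h
  linarith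

/-! ## 2. Parity of the multiplicity count -/

/-- The number of roots in `(x, y)` counted WITH multiplicity is congruent modulo `2` to the number of roots of ODD
multiplicity in `(x, y)`. -/
theorem countP_roots_mod_two (p : ℝ[X]) (x y : ℝ) :
    (p.roots.countP fun ρ => x < ρ ∧ ρ < y) % 2 =
      ((p.roots.toFinset.filter fun ρ => x < ρ ∧ ρ < y).filter fun ρ => Odd (p.rootMultiplicity ρ)).card % 2 := by
  classical
  have hsum : (p.roots.countP fun ρ => x < ρ ∧ ρ < y) =
      ∑ ρ ∈ (p.roots.toFinset.filter fun ρ => x < ρ ∧ ρ < y), p.rootMultiplicity ρ := by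
    rw [Multiset.countP_eq_card_filter, ← Multiset.toFinset_sum_count_eq, Multiset.toFinset_filter]
    refine Finset.sum_congr rfl fun ρ hρ => ?_
    rw [Multiset.count_filter, if_pos (Finset.mem_filter.mp hρ).2, Polynomial.count_roots]
  have hmod : ∀ k : ℕ, k % 2 = if Odd k then 1 else 0 := by
    intro k
    split_ifs with h
    · exact Nat.odd_iff.mp h
    · exact Nat.even_iff.mp (Nat.not_odd_iff_even.mp h)
  rw [hsum, Finset.sum_nat_mod, Finset.sum_congr rfl (fun ρ _ => hmod (p.rootMultiplicity ρ)), Finset.sum_boole,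
    Nat.cast_id]

/-- One odd-multiplicity root in `(x, y)` (and any number of even ones) ⇒ an odd count with multiplicity. -/
theorem countP_roots_odd_of_card_eq_one (p : ℝ[X]) (x y : ℝ)
    (h : ((p.roots.toFinset.filter fun ρ => x < ρ ∧ ρ < y).filter fun ρ => Odd (p.rootMultiplicity ρ)).card = 1) :
    Odd (p.roots.countP fun ρ => x < ρ ∧ ρ < y) := by
  rw [Nat.odd_iff, countP_roots_mod_two, h]

/-! ## 3. Odd-multiplicity positive roots give an alternating chain -/

/-- **Half (a) of the perturbation lemma.**  If a real polynomial `p ≠ 0` has `n` positive roots of ODD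
multiplicity, there are positive points `τ_0 < τ_1 < ⋯ < τ_n` along which `p` strictly alternates in sign. -/
theorem exists_alternation_of_odd_roots (p : ℝ[X]) (hp : p ≠ 0) (n : ℕ)
    (hn : ((p.roots.toFinset.filter fun ρ => 0 < ρ).filter fun ρ => Odd (p.rootMultiplicity ρ)).card = n) :
    ∃ τ : Fin (n + 1) → ℝ, StrictMono τ ∧ (∀ j, 0 < τ j) ∧
      ∀ j : Fin n, p.eval (τ j.castSucc) * p.eval (τ j.succ) < 0 := by
  classical
  set R := (p.roots.toFinset.filter fun ρ => 0 < ρ).filter fun ρ => Odd (p.rootMultiplicity ρ) with hRdef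
  -- increasing enumeration of the odd positive roots
  set r : Fin n ↪o ℝ := R.orderEmbOfFin hn with hrdef
  have hr_mem : ∀ k, r k ∈ R := fun k => Finset.orderEmbOfFin_mem R hn k
  have hr_pos : ∀ k, 0 < r k := fun k =>
    (Finset.mem_filter.mp (Finset.mem_filter.mp (hr_mem k)).1).2
  have hr_root : ∀ k, r k ∈ p.roots.toFinset := fun k =>
    (Finset.mem_filter.mp (Finset.mem_filter.mp (hr_mem k)).1).1
  have hr_odd : ∀ k, Odd (p.rootMultiplicity (r k)) := fun k => (Finset.mem_filter.mp (hr_mem k)).2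
  have hr_surj : ∀ ρ ∈ R, ∃ k, r k = ρ := by
    intro ρ hρ
    have : ρ ∈ Set.range r := by rw [hrdef, Finset.range_orderEmbOfFin]; exact hρ
    exact this
  -- the fences: τ_j will be taken in (lo j, hi j)
  let lo : Fin (n + 1) → ℝ := fun j => if h : (j : ℕ) = 0 then 0 else r ⟨(j : ℕ) - 1, by omega⟩
  let hi : Fin (n + 1) → ℝ := fun j => if h : (j : ℕ) < n then r ⟨j, h⟩ else lo j + 1
  have hhi : ∀ j : Fin n, hi j.castSucc = r j := by
    intro j
    simp only [hi, Fin.val_castSucc, j.2, dite_true]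
  have hlo : ∀ j : Fin n, lo j.succ = r j := by
    intro j
    simp only [lo, Fin.val_succ, Nat.add_one_ne_zero, dite_false]
    congr 1
  have hlo_nonneg : ∀ j, 0 ≤ lo j := by
    intro j
    simp only [lo]
    split_ifs with h
    · exact le_rfl
    · exact (hr_pos _).le
  have hlohi : ∀ j, lo j < hi j := by
    intro j
    simp only [hi]
    split_ifs with h
    · simp only [lo]
      split_ifs with h0
      · exact hr_pos _
      · exact r.strictMono (by simp only [Fin.mk_lt_mk]; omega)
    · linarith
  -- choose τ_j in (lo j, hi j) avoiding all roots of p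
  have hchoice : ∀ j : Fin (n + 1), ∃ t, lo j < t ∧ t < hi j ∧ t ∉ p.roots.toFinset := by
    intro j
    obtain ⟨t, ht⟩ := ((Set.Ioo_infinite (hlohi j)).sdiff (p.roots.toFinset.finite_toSet)).nonempty
    exact ⟨t, ht.1.1, ht.1.2, ht.2⟩
  choose τ hτlo hτhi hτroot using hchoice
  have hτeval : ∀ j, p.eval (τ j) ≠ 0 := by
    intro j h
    exact hτroot j (Multiset.mem_toFinset.mpr ((Polynomial.mem_roots hp).mpr h))
  refine ⟨τ, ?_, fun j => (hlo_nonneg j).trans_lt (hτlo j), fun j => ?_⟩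
  · -- strictly increasing
    refine Fin.strictMono_iff_lt_succ.mpr fun j => ?_
    calc τ j.castSucc < hi j.castSucc := hτhi _
      _ = lo j.succ := by rw [hhi, hlo]
      _ < τ j.succ := hτlo _
  · -- exactly one odd-multiplicity root between τ_j and τ_{j+1}: namely r j
    have hlt : τ j.castSucc < τ j.succ := by
      calc τ j.castSucc < hi j.castSucc := hτhi _
        _ = lo j.succ := by rw [hhi, hlo]
        _ < τ j.succ := hτlo _
    refine eval_mul_eval_neg_of_odd p hp _ _ hlt (hτeval _) (hτeval _)
      (countP_roots_odd_of_card_eq_one p _ _ ?_)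
    rw [Finset.card_eq_one]
    refine ⟨r j, Finset.eq_singleton_iff_unique_mem.mpr ⟨?_, ?_⟩⟩
    · -- r j lies strictly between
      refine Finset.mem_filter.mpr ⟨Finset.mem_filter.mpr ⟨hr_root j, ?_, ?_⟩, hr_odd j⟩
      · calc τ j.castSucc < hi j.castSucc := hτhi _
          _ = r j := hhi j
      · calc r j = lo j.succ := (hlo j).symm
          _ < τ j.succ := hτlo _
    · -- uniqueness: an odd positive root strictly between is some r k with k = j
      intro ρ hρ
      obtain ⟨hρ1, hρodd⟩ := Finset.mem_filter.mp hρ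
      obtain ⟨hρroot, hρx, hρy⟩ := Finset.mem_filter.mp hρ1
      have hρpos : 0 < ρ := (hlo_nonneg _).trans_lt ((hτlo _).trans hρx)
      obtain ⟨k, rfl⟩ := hr_surj ρ
        (Finset.mem_filter.mpr ⟨Finset.mem_filter.mpr ⟨hρroot, hρpos⟩, hρodd⟩)
      -- k ≤ j from r k < τ j.succ < hi j.succ
      have hk1 : (k : ℕ) ≤ j := by
        have hlt' : r k < hi j.succ := hρy.trans (hτhi _)
        simp only [hi, Fin.val_succ] at hlt'
        split_ifs at hlt' with h
        · have := r.strictMono.lt_iff_lt.mp hlt'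
          simp only [Fin.lt_def] at this
          omega
        · omega
      -- j ≤ k from lo j.castSucc < τ j.castSucc < r k
      have hk2 : (j : ℕ) ≤ k := by
        have hlt' : lo j.castSucc < r k := (hτlo _).trans hρx
        simp only [lo, Fin.val_castSucc] at hlt'
        split_ifs at hlt' with h
        · omega
        · have := r.strictMono.lt_iff_lt.mp hlt'
          simp only [Fin.lt_def] at this
          omega
      congr 1
      exact Fin.ext (le_antisymm hk1 hk2)

/-! ## 4. Consequences in the stub's (unfolded) vocabulary -/

/-- **Odd-multiplicity positive roots are bounded by the alternation bound.**  Under the hypothesis of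
`PerturbToAlternation` for the format `(d, m)` with bound `B` (every symmetric pencil of that format has at most `B`
strict sign alternations of its determinant along positive points), every symmetric pencil of that format has at most
`B` positive roots of ODD multiplicity.  (The residual half of the stub: each positive root of EVEN multiplicity of
`det F` yields, for one sign `s` and all small `ε > 0`, a sign change of `det (F + s ε X^{d_{l₀}} E)` near it for a
generic `E ≻ 0` — NOT proved here.) -/
theorem card_oddPosRoots_le (K m : ℕ) (d : Fin K → ℕ) (B : ℕ)
    (H : ∀ S : Fin K → Matrix (Fin m) (Fin m) ℝ, (∀ l, (S l).IsSymm) →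
      ∀ (N : ℕ) (τ : Fin (N + 1) → ℝ),
        (StrictMono τ ∧ (∀ j, 0 < τ j) ∧ ∀ j : Fin N,
          (∑ l, (Polynomial.X : ℝ[X]) ^ d l • (S l).map Polynomial.C).det.eval (τ j.castSucc) *
            (∑ l, (Polynomial.X : ℝ[X]) ^ d l • (S l).map Polynomial.C).det.eval (τ j.succ) < 0) → N ≤ B)
    (S : Fin K → Matrix (Fin m) (Fin m) ℝ) (hS : ∀ l, (S l).IsSymm) :
    (((∑ l, (Polynomial.X : ℝ[X]) ^ d l • (S l).map Polynomial.C).det.roots.toFinset.filter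
        fun ρ => 0 < ρ).filter fun ρ =>
          Odd ((∑ l, (Polynomial.X : ℝ[X]) ^ d l • (S l).map Polynomial.C).det.rootMultiplicity ρ)).card ≤ B := by
  classical
  set p := (∑ l, (Polynomial.X : ℝ[X]) ^ d l • (S l).map Polynomial.C).det with hpdef
  by_cases hp : p = 0
  · simp [hp]
  obtain ⟨τ, hmono, hpos, halt⟩ := exists_alternation_of_odd_roots p hp _ rfl
  exact H S hS _ τ ⟨hmono, hpos, halt⟩

/-- **The stub's conclusion when all positive roots are of odd multiplicity.**  Under the hypothesis of
`PerturbToAlternation` (format `(d, m)`, bound `B`), a symmetric pencil of that format all of whose positive roots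
have odd multiplicity has `posRootCount ≤ B ≤ 2B`. -/
theorem posRootCount_le_of_odd (K m : ℕ) (d : Fin K → ℕ) (B : ℕ)
    (H : ∀ S : Fin K → Matrix (Fin m) (Fin m) ℝ, (∀ l, (S l).IsSymm) →
      ∀ (N : ℕ) (τ : Fin (N + 1) → ℝ),
        (StrictMono τ ∧ (∀ j, 0 < τ j) ∧ ∀ j : Fin N,
          (∑ l, (Polynomial.X : ℝ[X]) ^ d l • (S l).map Polynomial.C).det.eval (τ j.castSucc) *
            (∑ l, (Polynomial.X : ℝ[X]) ^ d l • (S l).map Polynomial.C).det.eval (τ j.succ) < 0) → N ≤ B)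
    (S : Fin K → Matrix (Fin m) (Fin m) ℝ) (hS : ∀ l, (S l).IsSymm)
    (hodd : ∀ ρ ∈ ((∑ l, (Polynomial.X : ℝ[X]) ^ d l • (S l).map Polynomial.C).det.roots.toFinset.filter
        fun ρ => 0 < ρ), Odd ((∑ l, (Polynomial.X : ℝ[X]) ^ d l • (S l).map Polynomial.C).det.rootMultiplicity ρ)) :
    ((∑ l, (Polynomial.X : ℝ[X]) ^ d l • (S l).map Polynomial.C).det.roots.toFinset.filter
        fun ρ => 0 < ρ).card ≤ 2 * B := by
  classical
  have h := card_oddPosRoots_le K m d B H S hS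
  rw [Finset.filter_true_of_mem hodd] at h
  omega

end Perturb

end Summit.ValiantsHypothesis.ValiantsHypothesis.Theorems.LacunarySymmetroidMatrixDescartes

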